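import Summits.QuantumFields.YangMills.Theorems.BalabanUVNodesN15KingModelCovariantKatoDomination
import Summits.QuantumFields.YangMills.Theorems.BalabanUVNodesN15KingModelFreeCovarianceDecay
import Summits.QuantumFields.YangMills.Theorems.BalabanUVNodesN15KingModelBoxSumRulesResolvent
import HarnessLib

/-!
# BalabanUVNodes ∕ N15 — THE KING-MODEL RUNG (PART Ͱ-e): N15's FINE COVARIANCE LAYER AT A LIVE LINK FIELD — UNIFORM EXPONENTIAL DECAY, KERNEL DOMINATION AND ROW SUMS OF
# `G_U = (−cΔ_U+m²)⁻¹` AT EVERY UNITARY `U`, WITH KING's `A = 0` CONSTANTS: `‖(G_U)_{xy}‖ ≤ (2∕m²)·C(κ_F,d)·e^{−(κ_F∕(d+1))·d_T(x,y)}`, `‖(G_Uf)(x)‖ ≤ Σ_y G(x,y)‖f(y)‖`, `Σ_y‖(G_U)_{xy}‖ ≤ 1∕m²`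
# (Track A, DAG node N15 = NE2 «η-rates of the covariance ∕ background pieces»; FAN-OUT v1.1 §N15 s3 «KING-MODEL RUNG»; count-neutral)

HONEST FRAMING.  Count-neutral (cell `pub-ymgap`, seat `pub-ymgap-dag-n15-e` g42; `--supports stmt-QuantumFields-27247 --as helper` = K3ᴬ, KEY MAP v3).  One finite torus at fixed
spacing; the decay constants are PART Ε-d's (crude, explicit, volume-uniform, rate `O(m)` per physical unit); the fine covariance layer only — NOT Bałaban's `G_k(U)` ∕ [B9] (3.42)
(the averaging penalty is not of Kato form, LOCATED in Ͱ-a's header); NOT a node discharge (N15 of record untouched); nothing continuum ∕ ℝ⁴ ∕ OS ∕ Clay.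

THE RESULT.  N15 = NE2 asks for the decay and the rates of the covariance pieces; on King's `A = 0` comparison model the fine piece `(c(−Δ)+m²)⁻¹` decays uniformly in the volume
(PART Ε-d ★★★ `abs_lapF_inv_le_exp_tdistT`, [Balaban1984PropagatorsI] (1.126), [King1986] (4.4)).  By PART Ͱ-b's Kato domination EVERY such magnitude statement transfers VERBATIM to
the covariant fine covariance `G_U` at an ARBITRARY unitary link field — this file writes the transfers out:
* §1 ★★★ **`norm_fib_inv_mulVec_le_sum`** — KERNEL DOMINATION: `‖(G_Uf)(x)‖_{𝕜ⁿ} ≤ Σ_y G(x,y)·‖f(y)‖_{𝕜ⁿ}` (Ͱ-b with the exact majorant `g = ‖f(·)‖`);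
* §2 ★★★ **`norm_inv_entry_le_exp_tdistT`** ∕ ★★★ **`l2_opNorm_blk_inv_le_exp_tdistT`** ∕ ★★ **`norm_blk_inv_mulVec_le_exp_tdistT`** — UNIFORM EXPONENTIAL DECAY AT EVERY `U`:
  `‖(G_U)_{xy}‖ ≤ (2∕m²)·periodConst κ_F d·e^{−(κ_F∕(d+1))·tdistT K x y}` entrywise, in fibre operator norm, and on vectors — the constants are King's (`κ_F = kappaFree c m² d`), the
  link field costs NOTHING; ★★ **`norm_fib_inv_mulVec_le_exp_sum`** (`‖(G_Uf)(x)‖ ≤ (2∕m²)C·Σ_y e^{−κ d(x,y)}‖f(y)‖`);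
* §3 ★★ **`sum_l2_opNorm_blk_inv_le_inv_mass`** ∕ ★★ **`sum_norm_inv_entry_le_inv_mass`** — ROW SUMS `Σ_y‖(G_U)_{xy}‖ ≤ Σ_yG(x,y) = 1∕m²` (Ϟ-s `sum_lapF_inv_eq_inv_mass`): the
  covariant fine covariance is an `ℓ^∞ → ℓ^∞` (and by symmetry `ℓ¹ → ℓ¹`) contraction times `m⁻²`, uniformly in `U` (cf. Ͱ-b `norm_fib_inv_mulVec_le_div_mass`).

PRIOR TREE ART (by name): Ͱ-a∕b (`covLapF`, `fib`, `blk`, `norm_fib_inv_mulVec_le`, `norm_blk_inv_mulVec_le`, `norm_inv_entry_le_lapF_inv`, `l2_opNorm_blk_inv_le`, `lapF_inv_entry_nonneg`),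
Ε-d (`abs_lapF_inv_le_exp_tdistT`), Ε-a (`kappaFree`), Ν-a (`lapF_inv_comm`), pv17 `B4TorusKernel.periodConst`, `King1986.Torus.tdistT`, Ϟ-s (`sum_lapF_inv_eq_inv_mass`).
Dedup (rg at filing): basename 0 files; needles `norm_fib_inv_mulVec_le_sum|norm_inv_entry_le_exp_tdistT|l2_opNorm_blk_inv_le_exp_tdistT|sum_l2_opNorm_blk_inv_le_inv_mass` 0 tree files.
Locators: [King1986] (4.4) p.670, Lemma 4.5 (4.38) p.674 (the node's rate display, `A = 0`); [Balaban1984PropagatorsI] p.38 (1.126); [Balaban1985BackgroundPropagators] (3.23) p.394, Thm 3.1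
(3.42) p.397 (value row; print's method is the random walk expansion p.398 — NOT reproduced); [DodziukMathai2006] §1 Thm 1.5.  0 `sorry`, 0 `def`.
-/

noncomputable section

open scoped BigOperators ComplexConjugate ComplexOrder Kronecker
open Finset Matrix WithLp

namespace Summit.QuantumFields.YangMills.BalabanUVNodes.N15KingModelRung.Covariant

open Literature.MathematicalPhysics.QuantumFieldTheory.LatticeDiamagneticInequality (Hopping blk)
open Literature.MathematicalPhysics.QuantumFieldTheory.Balaban1983to89.B5Prop11Plancherel (Tor unitVec)
open Literature.MathematicalPhysics.QuantumFieldTheory.Balaban1983to89.B4TorusKernel (periodConst)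
open Literature.MathematicalPhysics.QuantumFieldTheory.King1986.Torus (lapF tdistT)
open Summit.QuantumFields.YangMills.BalabanUVNodes.N15KingModelRung.TorusSpectral (kappaFree abs_lapF_inv_le_exp_tdistT sum_lapF_inv_eq_inv_mass lapF_inv_comm)

variable {d : ℕ} (K : Fin (d + 1) → ℕ) [hK : ∀ μ, NeZero (K μ)]
variable {𝕜 : Type*} [RCLike 𝕜] {n : Type*} [Fintype n] [DecidableEq n] {c m2 : ℝ}

/-! ## §1 Kernel domination -/

/-- ★★★ **KERNEL DOMINATION**: `‖(G_Uf)(x)‖_{𝕜ⁿ} ≤ Σ_y G(x,y)·‖f(y)‖_{𝕜ⁿ}` for every unitary link field `U`, every source `f`, every site `x` (`c ≥ 0`, `m² > 0`; `G = (lapF K c m²)⁻¹`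
King's `A = 0` covariance) — PART Ͱ-b's Kato domination with the exact majorant `g = ‖f(·)‖`. [cite: DodziukMathai2006, Thm 1.5 §1; King1986, (4.4) p.670; Balaban1985BackgroundPropagators, (3.42) p.397] -/
theorem norm_fib_inv_mulVec_le_sum (hc : 0 ≤ c) (hm : 0 < m2) {U : Tor K × Fin (d + 1) → Matrix n n 𝕜} (hU : ∀ b, U b ∈ Matrix.unitaryGroup n 𝕜)
    (f : Tor K × n → 𝕜) (x : Tor K) :
    ‖fib K ((covLapF K c m2 U)⁻¹ *ᵥ f) x‖ ≤ ∑ y, (lapF K c m2)⁻¹ x y * ‖fib K f y‖ := by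
  have h := norm_fib_inv_mulVec_le K hc hm hU (f := f) (g := fun y => ‖fib K f y‖) (fun _ => le_rfl) x
  simpa only [Matrix.mulVec, dotProduct] using h

/-! ## §2 Uniform exponential decay at every link field -/

/-- ★★★ **UNIFORM EXPONENTIAL DECAY OF THE COVARIANT FINE COVARIANCE, ENTRYWISE**: for every period vector `K`, `c ≥ 0`, `m² > 0`, every fibre, EVERY unitary `U`, all
`x, y, i, j`: `|G_U((x,i),(y,j))| ≤ (2∕m²)·periodConst κ_F d·e^{−(κ_F∕(d+1))·tdistT K x y}` — King's `A = 0` decay (Ε-d) transferred by Kato domination (Ͱ-b); the link field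
costs nothing. [cite: King1986, (4.4) p.670, (4.38) p.674; Balaban1984PropagatorsI, p.38 (1.126); Balaban1985BackgroundPropagators, (3.42) p.397] -/
theorem norm_inv_entry_le_exp_tdistT (hc : 0 ≤ c) (hm : 0 < m2) {U : Tor K × Fin (d + 1) → Matrix n n 𝕜} (hU : ∀ b, U b ∈ Matrix.unitaryGroup n 𝕜)
    (x y : Tor K) (i j : n) :
    ‖(covLapF K c m2 U)⁻¹ (x, i) (y, j)‖ ≤ 2 / m2 * periodConst (kappaFree c m2 d) d * Real.exp (-(kappaFree c m2 d / (d + 1) * tdistT K x y)) :=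
  (norm_inv_entry_le_lapF_inv K hc hm hU x y i j).trans ((le_abs_self _).trans (abs_lapF_inv_le_exp_tdistT K hc hm x y))

open scoped Matrix.Norms.L2Operator in
/-- ★★★ **THE SAME IN THE FIBRE OPERATOR NORM**: `‖(G_U)_{xy}‖_{op} ≤ (2∕m²)·periodConst κ_F d·e^{−(κ_F∕(d+1))·tdistT K x y}` at every unitary `U`.
[cite: King1986, (4.4) p.670; Balaban1984PropagatorsI, p.38 (1.126); Balaban1985BackgroundPropagators, (3.42) p.397] -/
theorem l2_opNorm_blk_inv_le_exp_tdistT (hc : 0 ≤ c) (hm : 0 < m2) {U : Tor K × Fin (d + 1) → Matrix n n 𝕜} (hU : ∀ b, U b ∈ Matrix.unitaryGroup n 𝕜) (x y : Tor K) :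
    ‖blk ((covLapF K c m2 U)⁻¹) x y‖ ≤ 2 / m2 * periodConst (kappaFree c m2 d) d * Real.exp (-(kappaFree c m2 d / (d + 1) * tdistT K x y)) :=
  (l2_opNorm_blk_inv_le K hc hm hU x y).trans ((le_abs_self _).trans (abs_lapF_inv_le_exp_tdistT K hc hm x y))

/-- ★★ **… AND ON VECTORS**: `‖(G_U)_{xy}e‖ ≤ (2∕m²)·periodConst κ_F d·e^{−(κ_F∕(d+1))·tdistT K x y}·‖e‖`. [cite: King1986, (4.4) p.670; Balaban1984PropagatorsI, p.38 (1.126)] -/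
theorem norm_blk_inv_mulVec_le_exp_tdistT (hc : 0 ≤ c) (hm : 0 < m2) {U : Tor K × Fin (d + 1) → Matrix n n 𝕜} (hU : ∀ b, U b ∈ Matrix.unitaryGroup n 𝕜)
    (x y : Tor K) (e : n → 𝕜) :
    ‖toLp 2 (blk ((covLapF K c m2 U)⁻¹) x y *ᵥ e)‖ ≤ 2 / m2 * periodConst (kappaFree c m2 d) d * Real.exp (-(kappaFree c m2 d / (d + 1) * tdistT K x y)) * ‖toLp 2 e‖ :=
  (norm_blk_inv_mulVec_le K hc hm hU x y e).trans
    (mul_le_mul_of_nonneg_right ((le_abs_self _).trans (abs_lapF_inv_le_exp_tdistT K hc hm x y)) (norm_nonneg _))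

/-- ★★ **EXPONENTIALLY WEIGHTED KERNEL DOMINATION**: `‖(G_Uf)(x)‖ ≤ (2∕m²)·periodConst κ_F d·Σ_y e^{−(κ_F∕(d+1))·tdistT K x y}·‖f(y)‖` at every unitary `U` — the response to a
source decays exponentially away from its support, uniformly in the link field and the volume. [cite: King1986, (4.4) p.670, (4.38) p.674; Balaban1984PropagatorsI, p.38 (1.126)] -/
theorem norm_fib_inv_mulVec_le_exp_sum (hc : 0 ≤ c) (hm : 0 < m2) {U : Tor K × Fin (d + 1) → Matrix n n 𝕜} (hU : ∀ b, U b ∈ Matrix.unitaryGroup n 𝕜)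
    (f : Tor K × n → 𝕜) (x : Tor K) :
    ‖fib K ((covLapF K c m2 U)⁻¹ *ᵥ f) x‖
      ≤ 2 / m2 * periodConst (kappaFree c m2 d) d * ∑ y, Real.exp (-(kappaFree c m2 d / (d + 1) * tdistT K x y)) * ‖fib K f y‖ := by
  refine (norm_fib_inv_mulVec_le_sum K hc hm hU f x).trans ?_
  rw [Finset.mul_sum]
  refine Finset.sum_le_sum fun y _ => ?_
  rw [← mul_assoc]
  exact mul_le_mul_of_nonneg_right ((le_abs_self _).trans (abs_lapF_inv_le_exp_tdistT K hc hm x y)) (norm_nonneg _)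

/-! ## §3 Row sums: `ℓ^∞ → ℓ^∞` contraction times `m⁻²`, uniformly in `U` -/

open scoped Matrix.Norms.L2Operator in
/-- ★★ **ROW SUMS OF THE BLOCK NORMS**: `Σ_y‖(G_U)_{xy}‖_{op} ≤ Σ_yG(x,y) = 1∕m²` at every unitary `U` (Ͱ-b + Ϟ-s `sum_lapF_inv_eq_inv_mass`).
[cite: King1986, (2.17) p.653, (4.4) p.670; Balaban1985BackgroundPropagators, (3.39)∕(3.42) p.397] -/
theorem sum_l2_opNorm_blk_inv_le_inv_mass (hc : 0 ≤ c) (hm : 0 < m2) {U : Tor K × Fin (d + 1) → Matrix n n 𝕜} (hU : ∀ b, U b ∈ Matrix.unitaryGroup n 𝕜) (x : Tor K) :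
    ∑ y, ‖blk ((covLapF K c m2 U)⁻¹) x y‖ ≤ m2⁻¹ := by
  rw [← sum_lapF_inv_eq_inv_mass K hc hm x]
  exact Finset.sum_le_sum fun y _ => l2_opNorm_blk_inv_le K hc hm hU x y

/-- ★★ **ROW SUMS OF THE ENTRIES**: `Σ_y|G_U((x,i),(y,j))| ≤ 1∕m²` for all `i, j`, every unitary `U`. [cite: King1986, (2.17) p.653, (4.4) p.670] -/
theorem sum_norm_inv_entry_le_inv_mass (hc : 0 ≤ c) (hm : 0 < m2) {U : Tor K × Fin (d + 1) → Matrix n n 𝕜} (hU : ∀ b, U b ∈ Matrix.unitaryGroup n 𝕜)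
    (x : Tor K) (i j : n) : ∑ y, ‖(covLapF K c m2 U)⁻¹ (x, i) (y, j)‖ ≤ m2⁻¹ := by
  rw [← sum_lapF_inv_eq_inv_mass K hc hm x]
  exact Finset.sum_le_sum fun y _ => norm_inv_entry_le_lapF_inv K hc hm hU x y i j

/-- ★★ **COLUMN SUMS** (by the symmetry `G(x,y) = G(y,x)` of King's covariance): `Σ_x|G_U((x,i),(y,j))| ≤ 1∕m²`. [cite: King1986, (2.17) p.653, (4.4) p.670] -/
theorem sum_norm_inv_entry_le_inv_mass' (hc : 0 ≤ c) (hm : 0 < m2) {U : Tor K × Fin (d + 1) → Matrix n n 𝕜} (hU : ∀ b, U b ∈ Matrix.unitaryGroup n 𝕜)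
    (y : Tor K) (i j : n) : ∑ x, ‖(covLapF K c m2 U)⁻¹ (x, i) (y, j)‖ ≤ m2⁻¹ := by
  rw [← sum_lapF_inv_eq_inv_mass K hc hm y]
  exact Finset.sum_le_sum fun x _ => (norm_inv_entry_le_lapF_inv K hc hm hU x y i j).trans (le_of_eq (lapF_inv_comm K c m2 x y))

end Summit.QuantumFields.YangMills.BalabanUVNodes.N15KingModelRung.Covariant

end
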